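import Summits.QuantumFields.YangMills.Theorems.ColdStartUniversalityLatticeLangevinErgodicAverage
import Summits.QuantumFields.YangMills.Theorems.ColdStartUniversalityLatticeLangevinPoissonEquation
import HarnessLib

/-!
# Route `ColdStartUniversality` (fixed-cut-off SZZ dynamics, sampler theory):
# THE GREEN–KUBO LEMMA — variance of a time integral vs. `2T∫₀^∞ φ` for an asymptotically stationary, exponentially decorrelating field

Helper file (seat `ym-line-csu-p1`, g33, file 66; generic measure theory, no SZZ input).  Let `g : ℝ → Ω → ℝ` be a bounded jointly
measurable random field on a probability space and `φ : ℝ → ℝ` a measurable «stationary autocorrelation function» such that, for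
`0 < r ≤ r' ≤ T`,
* `|E[g_r g_(r')] − φ(r' − r)| ≤ C₁ e^(−c r)`   (convergence to stationarity at the EARLIER time),
* `|E[g_r g_(r')]| ≤ C₂ e^(−c (r' − r))` and `|φ(u)| ≤ C₂ e^(−cu)` (`u ≥ 0`)   (decorrelation).
Then (`abs_integral_sq_setIntegral_sub_le_of_twoTime`)

  `| E[(∫_(0,T] g_r dr)²] − 2T·∫_(0,∞) φ(u) du | ≤ (32 C₁ + 68 C₂)/c²`   for every `T ≥ 0`:

the variance of the time integral is `σ² T + O(1)` with the GREEN–KUBO constant `σ² = 2∫₀^∞ φ`.  Proof: Fubini on `Ω × (0,T]²`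
(as in `integral_sq_setIntegral_le_of_twoTime`), the pointwise comparison `|E[g_r g_(r')] − φ(|r'−r|)| ≤ (C₁+2C₂)e^(−c·min/2)e^(−c|r'−r|/2)`,
the exact evaluation `∫∫_((0,T]²) φ(|r'−r|) = 2∫₀ᵀ Φ` (`Φ(s) = ∫₀ˢ φ`) and the tail estimate `|Φ(s) − Φ(∞)| ≤ (C₂/c)e^(−cs)`.
File 67 applies it to the SU(2) SZZ dynamics (inputs: files 48, 53 and every-start mixing).  THEOREMS ONLY, no sorry.  HONEST FRAMING:
pure real analysis; nothing here is specific to Yang–Mills, no crux, rung or summit statement is touched; the Yang–Mills mass gap is NOT proved.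
-/

set_option autoImplicit false

noncomputable section

namespace Summit.QuantumFields.YangMills.Theorems.ColdStartUniversality

open MeasureTheory ProbabilityTheory Filter Topology Set
open scoped NNReal ENNReal BigOperators

/-! ## §1. Exponential bookkeeping -/

/-- `∫_(s,∞) e^(−cu) du = e^(−cs)/c` for `c > 0`. [folklore] -/
theorem setIntegral_Ioi_exp_neg_mul {c : ℝ} (hc : 0 < c) (s : ℝ) :
    ∫ u in Ioi s, Real.exp (-c * u) = Real.exp (-c * s) / c := by
  rw [integral_exp_mul_Ioi (neg_lt_zero.2 hc) s, neg_div_neg_eq]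

/-- `∫_(0,T] e^(−cu) du ≤ 2/c` (crude). [folklore] -/
theorem setIntegral_Ioc_exp_neg_mul_le {c : ℝ} (hc : 0 < c) (T : ℝ) :
    ∫ u in Ioc 0 T, Real.exp (-c * u) ≤ 2 / c := by
  calc ∫ u in Ioc 0 T, Real.exp (-c * u) = ∫ u in Ioc 0 T, Real.exp (-c * |u - 0|) :=
        setIntegral_congr_fun measurableSet_Ioc fun u hu => by rw [sub_zero, abs_of_pos hu.1]
    _ ≤ 2 / c := setIntegral_exp_neg_mul_abs_sub_le hc _ 0

/-! ## §2. The Green–Kubo lemma -/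

/-- ★★ **Green–Kubo lemma.**  For a bounded jointly measurable field `g` and a measurable `φ` with
`|E[g_r g_(r')] − φ(r'−r)| ≤ C₁e^(−cr)`, `|E[g_r g_(r')]| ≤ C₂e^(−c(r'−r))` (`0 < r ≤ r' ≤ T`) and `|φ(u)| ≤ C₂e^(−cu)` (`u ≥ 0`):
`|E[(∫_(0,T] g_r dr)²] − 2T∫_(0,∞) φ| ≤ (32C₁ + 68C₂)/c²`. [folklore] -/
theorem abs_integral_sq_setIntegral_sub_le_of_twoTime {Ω : Type*} [MeasurableSpace Ω] {P : Measure Ω} [IsProbabilityMeasure P]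
    {g : ℝ → Ω → ℝ} (hg : Measurable (Function.uncurry g)) {B : ℝ} (hB : ∀ r ω, |g r ω| ≤ B)
    {φ : ℝ → ℝ} (hφm : Measurable φ) {T : ℝ} (hT : 0 ≤ T) {C₁ C₂ c : ℝ} (hC₁ : 0 ≤ C₁) (hC₂ : 0 ≤ C₂) (hc : 0 < c)
    (hφb : ∀ u, 0 ≤ u → |φ u| ≤ C₂ * Real.exp (-c * u))
    (h1 : ∀ r ∈ Ioc 0 T, ∀ r' ∈ Ioc 0 T, r ≤ r' → |(∫ ω, g r ω * g r' ω ∂P) - φ (r' - r)| ≤ C₁ * Real.exp (-c * r))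
    (h2 : ∀ r ∈ Ioc 0 T, ∀ r' ∈ Ioc 0 T, r ≤ r' → |∫ ω, g r ω * g r' ω ∂P| ≤ C₂ * Real.exp (-c * (r' - r))) :
    |(∫ ω, (∫ r in Ioc 0 T, g r ω) ^ 2 ∂P) - 2 * T * ∫ u in Ioi 0, φ u| ≤ (32 * C₁ + 68 * C₂) / c ^ 2 := by
  set ν : Measure ℝ := volume.restrict (Ioc 0 T) with hν
  haveI : IsFiniteMeasure ν := isFiniteMeasure_restrict.2 measure_Ioc_lt_top.ne
  have hνmem : ∀ᵐ r ∂ν, r ∈ Ioc 0 T := by rw [hν]; exact ae_restrict_mem measurableSet_Ioc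
  have hK0 : 0 ≤ C₁ + 2 * C₂ := by positivity
  /- Step 0: the variance as a double integral of the two-time products (Fubini on `Ω × (0,T]²`) -/
  set M : ℝ × ℝ → ℝ := fun z => ∫ ω, g z.1 ω * g z.2 ω ∂P with hM
  have hsq : ∀ ω, (∫ r in Ioc 0 T, g r ω) ^ 2 = ∫ z, g z.1 ω * g z.2 ω ∂(ν.prod ν) := fun ω => by
    rw [sq, ← integral_prod_mul (μ := ν) (ν := ν) (fun r => g r ω) (fun r => g r ω)]
  have hm1 : Measurable fun q : Ω × (ℝ × ℝ) => g q.2.1 q.1 := hg.comp ((measurable_fst.comp measurable_snd).prodMk measurable_fst)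
  have hm2 : Measurable fun q : Ω × (ℝ × ℝ) => g q.2.2 q.1 := hg.comp ((measurable_snd.comp measurable_snd).prodMk measurable_fst)
  have hHb : ∀ q : Ω × (ℝ × ℝ), ‖g q.2.1 q.1 * g q.2.2 q.1‖ ≤ B * B := fun q => by
    rw [norm_mul, Real.norm_eq_abs, Real.norm_eq_abs]
    exact mul_le_mul (hB _ _) (hB _ _) (abs_nonneg _) ((abs_nonneg _).trans (hB q.2.1 q.1))
  have hInt : Integrable (Function.uncurry fun (ω : Ω) (z : ℝ × ℝ) => g z.1 ω * g z.2 ω) (P.prod (ν.prod ν)) :=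
    (integrable_const (B * B)).mono' (hm1.mul hm2).aestronglyMeasurable (Eventually.of_forall fun q => hHb q)
  have hV : ∫ ω, (∫ r in Ioc 0 T, g r ω) ^ 2 ∂P = ∫ z, M z ∂(ν.prod ν) := by
    rw [integral_congr_ae (ae_of_all _ hsq)]
    exact integral_integral_swap hInt
  have hMi : Integrable M (ν.prod ν) := hInt.integral_prod_right
  have hMsymm : ∀ z : ℝ × ℝ, M z.swap = M z := fun z => by
    simp only [hM, Prod.fst_swap, Prod.snd_swap]
    exact integral_congr_ae (ae_of_all _ fun ω => mul_comm _ _)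
  /- Step 1: the symmetrised autocorrelation `ψ = φ ∘ |·|` and the pointwise comparison -/
  set ψ : ℝ → ℝ := fun u => φ |u| with hψ
  have hψm : Measurable ψ := hφm.comp measurable_id.abs
  have hψb : ∀ u, |ψ u| ≤ C₂ := fun u => by
    refine (hφb |u| (abs_nonneg u)).trans (mul_le_of_le_one_right hC₂ ?_)
    rw [Real.exp_le_one_iff, neg_mul, neg_nonpos]
    exact mul_nonneg hc.le (abs_nonneg u)
  set Φ₂ : ℝ × ℝ → ℝ := fun z => ψ (z.2 - z.1) with hΦ₂
  have hΦ₂m : Measurable Φ₂ := hψm.comp (measurable_snd.sub measurable_fst)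
  have hΦ₂i : Integrable Φ₂ (ν.prod ν) :=
    (integrable_const C₂).mono' hΦ₂m.aestronglyMeasurable (Eventually.of_forall fun z => by
      rw [Real.norm_eq_abs]; exact hψb _)
  have hcase : ∀ r ∈ Ioc 0 T, ∀ r' ∈ Ioc 0 T, r ≤ r' →
      |M (r, r') - φ (r' - r)| ≤ (C₁ + 2 * C₂) * (Real.exp (-(c / 2) * r) * Real.exp (-(c / 2) * (r' - r))) := by
    intro r hr r' hr' hle
    have hu0 : 0 ≤ r' - r := sub_nonneg.2 hle
    have hr0 : 0 ≤ r := hr.1.le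
    have b1 : |M (r, r') - φ (r' - r)| ≤ C₁ * Real.exp (-c * r) := h1 r hr r' hr' hle
    have b2 : |M (r, r') - φ (r' - r)| ≤ 2 * C₂ * Real.exp (-c * (r' - r)) := by
      calc |M (r, r') - φ (r' - r)| ≤ |M (r, r')| + |φ (r' - r)| := abs_sub _ _
        _ ≤ C₂ * Real.exp (-c * (r' - r)) + C₂ * Real.exp (-c * (r' - r)) := add_le_add (h2 r hr r' hr' hle) (hφb _ hu0)
        _ = 2 * C₂ * Real.exp (-c * (r' - r)) := by ring
    have hee : Real.exp (-c * r) = Real.exp (-(c / 2) * r) * Real.exp (-(c / 2) * r) := by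
      rw [← Real.exp_add]; congr 1; ring
    have hee' : Real.exp (-c * (r' - r)) = Real.exp (-(c / 2) * (r' - r)) * Real.exp (-(c / 2) * (r' - r)) := by
      rw [← Real.exp_add]; congr 1; ring
    rcases le_total (r' - r) r with h | h
    · have hmono : Real.exp (-(c / 2) * r) ≤ Real.exp (-(c / 2) * (r' - r)) := Real.exp_le_exp.2 (by nlinarith)
      calc |M (r, r') - φ (r' - r)| ≤ C₁ * Real.exp (-c * r) := b1
        _ = C₁ * (Real.exp (-(c / 2) * r) * Real.exp (-(c / 2) * r)) := by rw [hee]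
        _ ≤ C₁ * (Real.exp (-(c / 2) * r) * Real.exp (-(c / 2) * (r' - r))) := by gcongr
        _ ≤ (C₁ + 2 * C₂) * (Real.exp (-(c / 2) * r) * Real.exp (-(c / 2) * (r' - r))) := by gcongr; linarith
    · have hmono : Real.exp (-(c / 2) * (r' - r)) ≤ Real.exp (-(c / 2) * r) := Real.exp_le_exp.2 (by nlinarith)
      calc |M (r, r') - φ (r' - r)| ≤ 2 * C₂ * Real.exp (-c * (r' - r)) := b2
        _ = 2 * C₂ * (Real.exp (-(c / 2) * (r' - r)) * Real.exp (-(c / 2) * (r' - r))) := by rw [hee']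
        _ ≤ 2 * C₂ * (Real.exp (-(c / 2) * r) * Real.exp (-(c / 2) * (r' - r))) := by gcongr
        _ ≤ (C₁ + 2 * C₂) * (Real.exp (-(c / 2) * r) * Real.exp (-(c / 2) * (r' - r))) := by gcongr; linarith
  -- the symmetric dominating kernel
  set E₁ : ℝ × ℝ → ℝ := fun z => Real.exp (-(c / 2) * z.1) * Real.exp (-(c / 2) * |z.2 - z.1|) with hE₁
  set E₂ : ℝ × ℝ → ℝ := fun z => Real.exp (-(c / 2) * z.2) * Real.exp (-(c / 2) * |z.2 - z.1|) with hE₂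
  have hptw : ∀ z : ℝ × ℝ, z.1 ∈ Ioc 0 T → z.2 ∈ Ioc 0 T → |M z - Φ₂ z| ≤ (C₁ + 2 * C₂) * (E₁ z + E₂ z) := by
    rintro ⟨r, r'⟩ hr hr'
    simp only [hΦ₂, hψ, hE₁, hE₂]
    rcases le_total r r' with hle | hle
    · have hab : |r' - r| = r' - r := abs_of_nonneg (sub_nonneg.2 hle)
      rw [hab]
      refine (hcase r hr r' hr' hle).trans (mul_le_mul_of_nonneg_left ?_ hK0)
      exact le_add_of_nonneg_right (by positivity)
    · have hab : |r' - r| = r - r' := by rw [abs_sub_comm]; exact abs_of_nonneg (sub_nonneg.2 hle)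
      have hsym : M (r, r') = M (r', r) := hMsymm (r', r)
      rw [hab, hsym]
      refine (hcase r' hr' r hr hle).trans (mul_le_mul_of_nonneg_left ?_ hK0)
      exact le_add_of_nonneg_left (by positivity)
  /- Step 2: `|∫M − ∫Φ₂| ≤ 32(C₁+2C₂)/c²` -/
  have h1' : ∀ᵐ z ∂(ν.prod ν), z.1 ∈ Ioc 0 T := (Measure.quasiMeasurePreserving_fst (μ := ν) (ν := ν)).ae hνmem
  have h2' : ∀ᵐ z ∂(ν.prod ν), z.2 ∈ Ioc 0 T := (Measure.quasiMeasurePreserving_snd (μ := ν) (ν := ν)).ae hνmem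
  have hE₁m : Measurable E₁ :=
    ((measurable_fst.const_mul _).exp).mul (((measurable_snd.sub measurable_fst).abs.const_mul _).exp)
  have hE₂m : Measurable E₂ :=
    ((measurable_snd.const_mul _).exp).mul (((measurable_snd.sub measurable_fst).abs.const_mul _).exp)
  have hexp_le_one : ∀ x : ℝ, 0 ≤ x → Real.exp (-(c / 2) * x) ≤ 1 := fun x hx => by
    rw [Real.exp_le_one_iff, neg_mul, neg_nonpos]; positivity
  have hE₁i : Integrable E₁ (ν.prod ν) := by
    refine (integrable_const (1 : ℝ)).mono' hE₁m.aestronglyMeasurable ?_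
    filter_upwards [h1'] with z hz
    rw [Real.norm_eq_abs, hE₁, abs_of_nonneg (by positivity)]
    exact mul_le_one₀ (hexp_le_one _ hz.1.le) (Real.exp_pos _).le (hexp_le_one _ (abs_nonneg _))
  have hE₂i : Integrable E₂ (ν.prod ν) := by
    refine (integrable_const (1 : ℝ)).mono' hE₂m.aestronglyMeasurable ?_
    filter_upwards [h2'] with z hz
    rw [Real.norm_eq_abs, hE₂, abs_of_nonneg (by positivity)]
    exact mul_le_one₀ (hexp_le_one _ hz.1.le) (Real.exp_pos _).le (hexp_le_one _ (abs_nonneg _))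
  have hE₁val : ∫ z, E₁ z ∂(ν.prod ν) ≤ 16 / c ^ 2 := by
    rw [integral_prod _ hE₁i]
    have hin : ∀ r, (∫ r', E₁ (r, r') ∂ν) ≤ Real.exp (-(c / 2) * r) * (4 / c) := fun r => by
      simp only [hE₁]
      rw [integral_const_mul, hν]
      refine mul_le_mul_of_nonneg_left ?_ (Real.exp_pos _).le
      calc ∫ r' in Ioc 0 T, Real.exp (-(c / 2) * |r' - r|) ≤ 2 / (c / 2) := setIntegral_exp_neg_mul_abs_sub_le (half_pos hc) _ r
        _ = 4 / c := by field_simp; ring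
    have hout : Integrable (fun r => Real.exp (-(c / 2) * r) * (4 / c)) ν :=
      ((Real.continuous_exp.comp (continuous_const.mul continuous_id)).mul continuous_const).integrableOn_Ioc.integrable
    calc ∫ r, (∫ r', E₁ (r, r') ∂ν) ∂ν ≤ ∫ r, Real.exp (-(c / 2) * r) * (4 / c) ∂ν :=
          integral_mono_of_nonneg (ae_of_all _ fun r => integral_nonneg fun r' => by simp only [hE₁]; positivity) hout
            (ae_of_all _ hin)
      _ = (∫ r, Real.exp (-(c / 2) * r) ∂ν) * (4 / c) := integral_mul_const _ _
      _ ≤ (2 / (c / 2)) * (4 / c) := by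
          gcongr
          rw [hν]
          exact setIntegral_Ioc_exp_neg_mul_le (half_pos hc) T
      _ = 16 / c ^ 2 := by field_simp; ring
  have hE₂val : ∫ z, E₂ z ∂(ν.prod ν) = ∫ z, E₁ z ∂(ν.prod ν) := by
    rw [← integral_prod_swap (μ := ν) (ν := ν) E₁]
    refine integral_congr_ae (ae_of_all _ fun z => ?_)
    simp only [hE₁, hE₂, Prod.fst_swap, Prod.snd_swap]
    rw [abs_sub_comm]
  have hdiff1 : |(∫ z, M z ∂(ν.prod ν)) - ∫ z, Φ₂ z ∂(ν.prod ν)| ≤ (C₁ + 2 * C₂) * (2 * (16 / c ^ 2)) := by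
    rw [← integral_sub hMi hΦ₂i]
    refine abs_integral_le_integral_abs.trans ?_
    have hle : ∀ᵐ z ∂(ν.prod ν), |M z - Φ₂ z| ≤ (C₁ + 2 * C₂) * (E₁ z + E₂ z) := by
      filter_upwards [h1', h2'] with z hz1 hz2 using hptw z hz1 hz2
    have hhi : Integrable (fun z => (C₁ + 2 * C₂) * (E₁ z + E₂ z)) (ν.prod ν) := (hE₁i.add hE₂i).const_mul _
    calc ∫ z, |M z - Φ₂ z| ∂(ν.prod ν) ≤ ∫ z, (C₁ + 2 * C₂) * (E₁ z + E₂ z) ∂(ν.prod ν) :=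
          integral_mono_ae (hMi.sub hΦ₂i).abs hhi hle
      _ = (C₁ + 2 * C₂) * ((∫ z, E₁ z ∂(ν.prod ν)) + ∫ z, E₂ z ∂(ν.prod ν)) := by
          rw [integral_const_mul, integral_add hE₁i hE₂i]
      _ ≤ (C₁ + 2 * C₂) * (2 * (16 / c ^ 2)) := by
          rw [hE₂val, ← two_mul]
          exact mul_le_mul_of_nonneg_left (mul_le_mul_of_nonneg_left hE₁val zero_le_two) hK0
  /- Step 3: `∫Φ₂ = 2∫₀ᵀ Φ`, `Φ(s) = ∫₀ˢ ψ` -/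
  have hψii : ∀ a b : ℝ, IntervalIntegrable ψ volume a b := fun a b => by
    refine (Measure.integrableOn_of_bounded (M := C₂) isCompact_uIcc.measure_lt_top.ne hψm.aestronglyMeasurable
      (ae_of_all _ fun u => ?_)).intervalIntegrable
    rw [Real.norm_eq_abs]; exact hψb u
  set Φ : ℝ → ℝ := fun s => ∫ u in (0 : ℝ)..s, ψ u with hΦ
  have hΦc : Continuous Φ := intervalIntegral.continuous_primitive hψii 0
  have hinner : ∀ r ∈ Ioc 0 T, ∫ r' in Ioc 0 T, Φ₂ (r, r') = Φ r + Φ (T - r) := by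
    intro r hr
    have hii : ∀ a b : ℝ, IntervalIntegrable (fun r' => Φ₂ (r, r')) volume a b := fun a b => by
      simpa [hΦ₂] using (hψii (a - r) (b - r)).comp_sub_right r
    rw [← intervalIntegral.integral_of_le hT, ← intervalIntegral.integral_add_adjacent_intervals (hii 0 r) (hii r T)]
    simp only [hΦ₂, hΦ]
    rw [intervalIntegral.integral_comp_sub_right (fun u => ψ u) r, intervalIntegral.integral_comp_sub_right (fun u => ψ u) r,
      zero_sub, sub_self]
    congr 1
    rw [show (∫ u in -r..0, ψ u) = ∫ u in -r..0, ψ (-u) from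
      intervalIntegral.integral_congr fun u _ => by simp only [hψ, abs_neg]]
    rw [intervalIntegral.integral_comp_neg (fun u => ψ u)]
    simp
  have hI : ∫ z, Φ₂ z ∂(ν.prod ν) = 2 * ∫ s in (0 : ℝ)..T, Φ s := by
    rw [integral_prod _ hΦ₂i]
    have hcongr : ∫ r, (∫ r', Φ₂ (r, r') ∂ν) ∂ν = ∫ r in Ioc 0 T, (Φ r + Φ (T - r)) := by
      rw [hν]; exact setIntegral_congr_fun measurableSet_Ioc fun r hr => hinner r hr
    rw [hcongr, ← intervalIntegral.integral_of_le hT,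
      intervalIntegral.integral_add (hΦc.intervalIntegrable _ _)
        ((show Continuous (fun x : ℝ => Φ (T - x)) from hΦc.comp (continuous_const.sub continuous_id)).intervalIntegrable
          _ _),
      intervalIntegral.integral_comp_sub_left (fun s => Φ s) T]
    simp only [sub_self, sub_zero]
    ring
  /- Step 4: the tail `|Φ(s) − ∫_(0,∞) ψ| ≤ (C₂/c) e^(−cs)` -/
  have hψIoi : IntegrableOn ψ (Ioi 0) volume := by
    refine Integrable.mono' ((exp_neg_integrableOn_Ioi 0 hc).const_mul C₂) hψm.aestronglyMeasurable ?_
    filter_upwards [ae_restrict_mem measurableSet_Ioi] with u hu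
    rw [Real.norm_eq_abs, hψ]
    simp only
    rw [abs_of_pos (mem_Ioi.1 hu)]
    exact hφb u (mem_Ioi.1 hu).le
  have hΦinf : ∫ u in Ioi 0, φ u = ∫ u in Ioi 0, ψ u :=
    setIntegral_congr_fun measurableSet_Ioi fun u hu => by simp only [hψ]; rw [abs_of_pos (mem_Ioi.1 hu)]
  have htail : ∀ s, 0 ≤ s → |Φ s - ∫ u in Ioi 0, ψ u| ≤ C₂ / c * Real.exp (-c * s) := by
    intro s hs
    rw [setIntegral_Ioi_eq_intervalIntegral_add hψIoi hs,
      show Φ s - ((∫ u in (0 : ℝ)..s, ψ u) + ∫ u in Ioi s, ψ u) = -∫ u in Ioi s, ψ u by simp only [hΦ]; ring, abs_neg]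
    calc |∫ u in Ioi s, ψ u| ≤ ∫ u in Ioi s, |ψ u| := abs_integral_le_integral_abs
      _ ≤ ∫ u in Ioi s, C₂ * Real.exp (-c * u) := by
          refine setIntegral_mono_on (hψIoi.mono_set (Ioi_subset_Ioi hs)).abs
            ((exp_neg_integrableOn_Ioi s hc).const_mul C₂) measurableSet_Ioi fun u hu => ?_
          have hu0 : 0 < u := hs.trans_lt (mem_Ioi.1 hu)
          simp only [hψ]
          rw [abs_of_pos hu0]
          exact hφb u hu0.le
      _ = C₂ / c * Real.exp (-c * s) := by rw [integral_const_mul, setIntegral_Ioi_exp_neg_mul hc s]; ring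
  /- Step 5: `|2∫₀ᵀ Φ − 2T Φ(∞)| ≤ 4C₂/c²` -/
  have hstep5 : |2 * (∫ s in (0 : ℝ)..T, Φ s) - 2 * T * ∫ u in Ioi 0, ψ u| ≤ 4 * C₂ / c ^ 2 := by
    have hconst : ∫ _s in (0 : ℝ)..T, (∫ u in Ioi 0, ψ u) = T * ∫ u in Ioi 0, ψ u := by
      rw [intervalIntegral.integral_const, smul_eq_mul, sub_zero]
    rw [show 2 * (∫ s in (0 : ℝ)..T, Φ s) - 2 * T * ∫ u in Ioi 0, ψ u =
        2 * ((∫ s in (0 : ℝ)..T, Φ s) - ∫ _s in (0 : ℝ)..T, (∫ u in Ioi 0, ψ u)) by rw [hconst]; ring,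
      ← intervalIntegral.integral_sub (hΦc.intervalIntegrable _ _) intervalIntegrable_const, abs_mul, abs_two]
    have hb : |∫ s in (0 : ℝ)..T, (Φ s - ∫ u in Ioi 0, ψ u)| ≤ C₂ / c * (2 / c) := by
      rw [intervalIntegral.integral_of_le hT]
      have hci : IntegrableOn (fun s => Φ s - ∫ u in Ioi 0, ψ u) (Ioc 0 T) volume :=
        (hΦc.sub continuous_const).integrableOn_Ioc
      have hei : IntegrableOn (fun s => C₂ / c * Real.exp (-c * s)) (Ioc 0 T) volume :=
        (continuous_const.mul (Real.continuous_exp.comp (continuous_const.mul continuous_id))).integrableOn_Ioc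
      calc |∫ s in Ioc 0 T, (Φ s - ∫ u in Ioi 0, ψ u)| ≤ ∫ s in Ioc 0 T, |Φ s - ∫ u in Ioi 0, ψ u| :=
            abs_integral_le_integral_abs
        _ ≤ ∫ s in Ioc 0 T, C₂ / c * Real.exp (-c * s) :=
            setIntegral_mono_on hci.abs hei measurableSet_Ioc fun s hs => htail s hs.1.le
        _ = C₂ / c * ∫ s in Ioc 0 T, Real.exp (-c * s) := integral_const_mul _ _
        _ ≤ C₂ / c * (2 / c) := mul_le_mul_of_nonneg_left (setIntegral_Ioc_exp_neg_mul_le hc T) (by positivity)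
    calc 2 * |∫ s in (0 : ℝ)..T, (Φ s - ∫ u in Ioi 0, ψ u)| ≤ 2 * (C₂ / c * (2 / c)) := by gcongr
      _ = 4 * C₂ / c ^ 2 := by field_simp; ring
  /- Step 6: assemble -/
  rw [hV, hΦinf]
  calc |(∫ z, M z ∂(ν.prod ν)) - 2 * T * ∫ u in Ioi 0, ψ u|
      ≤ |(∫ z, M z ∂(ν.prod ν)) - ∫ z, Φ₂ z ∂(ν.prod ν)| + |(∫ z, Φ₂ z ∂(ν.prod ν)) - 2 * T * ∫ u in Ioi 0, ψ u| :=
        abs_sub_le _ _ _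
    _ ≤ (C₁ + 2 * C₂) * (2 * (16 / c ^ 2)) + 4 * C₂ / c ^ 2 := add_le_add hdiff1 (by rw [hI]; exact hstep5)
    _ = (32 * C₁ + 68 * C₂) / c ^ 2 := by field_simp; ring

end Summit.QuantumFields.YangMills.Theorems.ColdStartUniversality

end
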